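import Literature.MathematicalPhysics.KineticTheory.PseudoTrajectoryComparisonStep
import Literature.MathematicalPhysics.KineticTheory.TaggedSphereLinearBoltzmann
import Literature.MathematicalPhysics.KineticTheory.TaggedBoltzmannTruncation
import HarnessLib

/-!
# The data of the comparison: initial marginals vs. the factorised Boltzmann datum on coupled pairs
# (BGSR Prop. 5.7, second bullet, and Prop. 3.3)
(Bodineau–Gallagher–Saint-Raymond, Invent. Math. 203 (2016) = arXiv:1305.3397v2, §5.3.3 proof of
Proposition 5.7, second bullet "Discrepancy between `f_N^{0(J_K)}(Z_{J_K}(0))` and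
`g^{0(J_K)}(Z^0_{J_K}(0))`", p. 21, with Proposition 3.3, p. 10; trunk T-KINETIC, topic
MathematicalPhysics/KineticTheory; the DATA layer of the comparison step of the bottom-up plan
towards the named fact `bgsr_linearBoltzmannApprox` (`TaggedSphereDiffusion`) recorded in
`TaggedSphereLinearBoltzmannRate`: the transported relational bound `IsRelLevelBddT` of
`HierarchyComparison` for the coupling `bgsrCouplingUpTo` of `PseudoTrajectoryComparisonStep`.)

BGSR p. 21: *"First of all, we note that for the coupled pseudo-trajectories
`g^{0(J_K)}(Z_{J_K}(0)) = g^{0(J_K)}(Z^0_{J_K}(0))`. Indeed, by construction both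
pseudo-trajectories have the same velocities and `x_1 = x_1^0`. The differences between the two
configurations are only on the positions of the particles added and `g^{0(J_K)}` is independent
of these positions. By Proposition 5.3, the initial data satisfies `Z_{J_K}(0) ∈ 𝒢_{J_K}(ε₀/2)`.
According to Proposition 3.3, we have
`‖1_{𝒢_{J_K}(ε₀/2)} (f_N^{0(J_K)} - g^{0(J_K)})‖_{0,J_K,β} ≤ ‖ρ⁰‖_{L^∞} C^{J_K} αε`."*

This file PROVES this for the tree's objects:

* `nthMarginal_congr_ae` — marginals of a.e.-equal functions are a.e. equal; hence
  (`bgsrInitialMarginals_ae_eq`) the honest initial marginals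
  `bgsrInitialMarginals … s = f_N^{0(s)} := nthMarginal (N+1) s f_N^0` (`s ≥ 1`) agree almost
  everywhere with the time-`0` values of the marginal family `bgsrMarginalFamily` of
  `HardSphereHierarchyModel` (which carry the indicator of the good set of the `(N+1)`-sphere
  flow inside the marginal and are therefore only a.e. equal to `f_N^{0(s)}`; the comparison needs
  pointwise values at the coupled configurations, the a.e. agreement is then fed through the
  hypothesis (R) of the BBGKY side);
* `isNice_bgsrInitialMarginals`, `isLevelBdd_bgsrInitialMarginals` — the Lanford class and the
  level bound `R (max 1 (2(β/2π)^{d/2}))^s e^{-βH}` (Props. 3.2, 4.1 at `t = 0`);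
* `isRelLevelBddT_bgsrInitialMarginals` — **Prop. 5.7, second bullet**: on the coupled pairs of
  `bgsrCouplingUpTo` (same velocities, same tagged position, BBGKY configuration in the hard-sphere
  domain), the energy-truncated data `1_{H ≤ E²/2} f_N^{0(s)}` and
  `1_{H ≤ E²/2} ρ⁰(x₀) M_β^{⊗s}` are `2R(N+1)(2ε)^d (max 1 (4(β/2π)^{d/2}))^s e^{-βH}`-close
  (`abs_nthMarginal_bgsrInitialDensity_sub_le`, Prop. 3.3, with `(s+1)2^{s+1} ≤ 2·4^s`).

## References

* T. Bodineau, I. Gallagher, L. Saint-Raymond, *The Brownian motion as the limit of a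
  deterministic system of hard-spheres*, Invent. Math. 203 (2016) 493–553 = arXiv:1305.3397v2,
  Prop. 3.3 p. 10; §5.3.3 Prop. 5.7 proof, p. 21.
-/

open MeasureTheory Metric Real Set Filter Function
open scoped InnerProductSpace ENNReal
open Literature.Analysis.FluidPDE (Config configEnergy Geometry GCState hardSphereDomain freeFlight
  nthMarginal marginal tensorPow bgsrGoodConfigs)
open Literature.Analysis.FunctionSpaces (maxwellianBeta)

namespace Literature.MathematicalPhysics.KineticTheory

noncomputable section

open Literature.Analysis.FunctionSpaces.Torus Literature.Analysis.FluidPDE.Torus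

section Kinetic

variable {d : Type*} [Fintype d]

/-! ## §1. Level bounds with a larger level constant -/

/-- Weakening of a level bound to a larger level constant `C₀ ≤ C₀'`. [folklore] -/
theorem IsLevelBdd.mono_const {X : Type*} {G : GCState d X} {L : ℕ} {R C₀ C₀' w : ℝ}
    (h : IsLevelBdd G L R C₀ w) (hR : 0 ≤ R) (hC₀ : 0 ≤ C₀) (hC : C₀ ≤ C₀') :
    IsLevelBdd G L R C₀' w := by
  intro a ha Z
  refine (h a ha Z).trans ?_
  have : C₀ ^ a ≤ C₀' ^ a := pow_le_pow_left₀ hC₀ hC a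
  gcongr

/-! ## §2. Marginals of almost everywhere equal functions -/

section Marginal

variable {X : Type*} [MeasureSpace X] [SigmaFinite (volume : Measure (X × EuclideanSpace ℝ d))]

/-- Marginals of a.e.-equal functions are a.e. equal (pull back along the measure-preserving
`appendMEquiv` and disintegrate: almost every section of an a.e.-null set is null); a private copy
of `marginal_congr_ae` of `Sweep1ReversedProofs`, not imported here. [folklore] -/
private theorem marginal_congr_ae' {s m : ℕ} {W₁ W₂ : Config (s + m) d X → ℝ} (h : W₁ =ᵐ[volume] W₂) :
    marginal s m W₁ =ᵐ[volume] marginal s m W₂ := by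
  have hmp := Literature.Analysis.FluidPDE.volume_preserving_appendMEquiv (X × EuclideanSpace ℝ d) s m
  have h1 : (fun p : Config s d X × Config m d X => W₁ (Fin.append p.1 p.2)) =ᵐ[(volume : Measure (Config s d X)).prod volume]
      fun p => W₂ (Fin.append p.1 p.2) := by
    filter_upwards [hmp.quasiMeasurePreserving.ae_eq h] with p hp
    simpa only [Function.comp_apply, Literature.Analysis.FluidPDE.appendMEquiv_apply] using hp
  filter_upwards [Measure.ae_ae_eq_curry_of_prod h1] with zs hzs
  exact integral_congr_ae hzs

/-- **`nthMarginal`s of a.e.-equal functions are a.e. equal.** [folklore] -/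
theorem nthMarginal_congr_ae {N s : ℕ} {W₁ W₂ : Config N d X → ℝ} (h : W₁ =ᵐ[volume] W₂) :
    nthMarginal N s W₁ =ᵐ[volume] nthMarginal N s W₂ := by
  by_cases hs : s ≤ N
  · rw [Literature.Analysis.FluidPDE.nthMarginal_of_le hs, Literature.Analysis.FluidPDE.nthMarginal_of_le hs]
    obtain ⟨e, he, hmp⟩ := Literature.Analysis.FluidPDE.exists_castEquiv (Nat.add_sub_of_le hs)
      (X × EuclideanSpace ℝ d)
    refine marginal_congr_ae' ?_
    filter_upwards [hmp.quasiMeasurePreserving.ae_eq h] with z hz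
    simpa only [Function.comp_apply, he] using hz
  · simp only [Literature.Analysis.FluidPDE.nthMarginal, dif_neg hs]
    exact EventuallyEq.rfl

end Marginal

/-! ## §3. The honest initial marginals -/

section Data

attribute [local instance] sigmaFinite_volume_phaseSpace

variable {ε : ℝ} (hε : 0 < ε) (hε' : ε < 2⁻¹) (N : ℕ) (β : ℝ) (ρ₀ : UnitAddTorus d → ℝ)

/-- **The initial marginals `f_N^{0(s)}` of BGSR's datum (2.8)**, honest version: at the levels
`s ≥ 1` the marginal `nthMarginal (N+1) s f_N^0` of the datum itself (BGSR §3.1: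
"`f_N^{(s)}(t, Z_s) := ∫ f_N(t, Z_N) dz_{s+1} … dz_N`" at `t = 0`), whose pointwise values on the
hard-sphere domain Proposition 3.3 controls; at the empty level `s = 0` (total mass, never used)
the value of `bgsrMarginalFamily`. Almost everywhere these are the time-`0` values of
`bgsrMarginalFamily` (`bgsrInitialMarginals_ae_eq`). [cite: BodineauGallagherSaintRaymondInvent2016, §3.1 and Prop. 3.3, pp. 9–10] -/
def bgsrInitialMarginals : GCState d (UnitAddTorus d)
  | 0 => bgsrMarginalFamily (d := d) hε hε' N β ρ₀ 0 0
  | s + 1 => nthMarginal (N + 1) (s + 1) (bgsrInitialDensity ε N β ρ₀)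

variable {hε hε' N β ρ₀}

/-- Unfolding at the levels `s + 1`. [folklore] -/
theorem bgsrInitialMarginals_succ (s : ℕ) :
    bgsrInitialMarginals hε hε' N β ρ₀ (s + 1) = nthMarginal (N + 1) (s + 1) (bgsrInitialDensity ε N β ρ₀) :=
  rfl

/-- BGSR's datum vanishes off the hard-sphere domain (the Gibbs density carries `1_{D_ε}`). [folklore] -/
theorem bgsrInitialDensity_eq_zero_of_not_mem {z : Config (N + 1) d (UnitAddTorus d)}
    (hz : z ∉ hardSphereDomain (Literature.Analysis.FluidPDE.Torus.geometry d) (N + 1) ε) :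
    bgsrInitialDensity ε N β ρ₀ z = 0 := by
  simp [bgsrInitialDensity, Literature.Analysis.FluidPDE.canonicalDensity, Set.indicator_of_notMem hz]

/-- **The honest initial marginals agree a.e. with the time-`0` marginal family** of
`HardSphereHierarchyModel` (the latter integrate `1_{good} f_N^0` instead of `f_N^0`; the two
integrands agree off `D_ε ∖ good`, a Liouville-null set, and marginals respect a.e. equality).
[folklore] -/
theorem bgsrInitialMarginals_ae_eq (s : ℕ) :
    bgsrInitialMarginals hε hε' N β ρ₀ s =ᵐ[volume] bgsrMarginalFamily (d := d) hε hε' N β ρ₀ s 0 := by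
  cases s with
  | zero => exact EventuallyEq.rfl
  | succ s =>
    rw [bgsrInitialMarginals_succ, bgsrMarginalFamily_apply]
    refine nthMarginal_congr_ae ?_
    set Φ := Literature.Analysis.FluidPDE.Alexander.regHardSphereFlow (d := d) hε hε' (N + 1) with hΦ
    have htr : Literature.Analysis.FluidPDE.hsTransport Φ 0 (bgsrInitialDensity ε N β ρ₀) =
        bgsrInitialDensity ε N β ρ₀ := by
      funext z
      rw [Literature.Analysis.FluidPDE.hsTransport_apply, neg_zero, hΦ,
        Literature.Analysis.FluidPDE.Alexander.regHardSphereFlow_flow,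
        Literature.Analysis.FluidPDE.Alexander.regFlow_zero hε hε']
    rw [htr]
    have hnull : ∀ᵐ z ∂(volume : Measure (Config (N + 1) d (UnitAddTorus d))),
        z ∉ Φ.goodᶜ ∩ hardSphereDomain (Literature.Analysis.FluidPDE.Torus.geometry d) (N + 1) ε := by
      have h := Φ.measure_compl_good
      rw [Literature.Analysis.FluidPDE.liouville_eq, Measure.restrict_apply Φ.measurableSet_good.compl] at h
      exact measure_eq_zero_iff_ae_notMem.1 h
    filter_upwards [hnull] with z hz
    by_cases hg : z ∈ Φ.good
    · rw [Set.indicator_of_mem hg]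
    · rw [Set.indicator_of_notMem hg]
      refine bgsrInitialDensity_eq_zero_of_not_mem fun hD => hz ⟨hg, hD⟩

/-- The honest initial marginals are measurable (measurable `ρ⁰`). [folklore] -/
theorem measurable_bgsrInitialMarginals (hρ₀m : Measurable ρ₀) (s : ℕ) :
    Measurable (bgsrInitialMarginals hε hε' N β ρ₀ s) := by
  cases s with
  | zero => exact measurable_bgsrMarginalFamily hε hε' N β ρ₀ hρ₀m 0 0
  | succ s =>
    rw [bgsrInitialMarginals_succ]
    exact Literature.Analysis.FluidPDE.measurable_nthMarginal _ _ (measurable_bgsrInitialDensity hρ₀m ε N β)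

/-- `(n + 2) 2^{n+2} ≤ 2 · 4^{n+1}`. [folklore] -/
theorem succ_succ_mul_two_pow_le (n : ℕ) : ((n : ℝ) + 2) * 2 ^ (n + 2) ≤ 2 * 4 ^ (n + 1) := by
  have h : ∀ n : ℕ, (n + 2) * 2 ^ (n + 2) ≤ 2 * 4 ^ (n + 1) := by
    intro n
    induction n with
    | zero => norm_num
    | succ n ih =>
      have h1 : (n + 1 + 2) * 2 ^ (n + 1 + 2) = 2 * ((n + 3) * 2 ^ (n + 2)) := by ring
      have h2 : (n + 3) * 2 ^ (n + 2) ≤ 2 * ((n + 2) * 2 ^ (n + 2)) := by nlinarith [Nat.one_le_two_pow (n := n + 2)]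
      calc (n + 1 + 2) * 2 ^ (n + 1 + 2) = 2 * ((n + 3) * 2 ^ (n + 2)) := h1
        _ ≤ 2 * (2 * ((n + 2) * 2 ^ (n + 2))) := by omega
        _ ≤ 2 * (2 * (2 * 4 ^ (n + 1))) := by omega
        _ = 2 * 4 ^ (n + 1 + 1) := by ring
  exact_mod_cast h n

/-- **Props. 3.2 / 4.1 at `t = 0` for the honest initial marginals**: in the regime
`N (2ε)^d ≤ 1/2`, for `0 ≤ ρ⁰ ≤ R`, `|f_N^{0(s)}(Z_s)| ≤ R (max 1 (2(β/2π)^{d/2}))^s e^{-β H(Z_s)}`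
at every level and configuration (`nthMarginal_canonicalDensity_le_two_pow`; the levels
`s > N + 1` vanish; level `0` is `abs_bgsrMarginalFamily_le`).
[cite: BodineauGallagherSaintRaymondInvent2016, Prop. 3.2 and §4.3 (4.6), pp. 10–12] -/
theorem abs_bgsrInitialMarginals_le (hβ : 0 < β) {R : ℝ} (hρ₀0 : ∀ x, 0 ≤ ρ₀ x) (hR : ∀ x, ρ₀ x ≤ R)
    (hN : (N : ℝ) * (2 * ε) ^ Fintype.card d ≤ 2⁻¹) (s : ℕ) (Z : Config s d (UnitAddTorus d)) :
    |bgsrInitialMarginals hε hε' N β ρ₀ s Z| ≤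
      R * (max 1 (2 * maxwellianConst d β)) ^ s * exp (-β * configEnergy Z) := by
  have hR0 : 0 ≤ R := (hρ₀0 0).trans (hR 0)
  cases s with
  | zero => exact abs_bgsrMarginalFamily_le hε hε' N β ρ₀ hβ hρ₀0 hR hN 0 0 Z
  | succ s =>
    rw [bgsrInitialMarginals_succ]
    by_cases hs : s + 1 ≤ N + 1
    · have hn : ((N + 1 - 1 : ℕ) : ℝ) * (2 * ε) ^ Fintype.card d ≤ 2⁻¹ := by simpa using hN
      have hnn : 0 ≤ nthMarginal (N + 1) (s + 1) (bgsrInitialDensity ε N β ρ₀) Z := by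
        rw [Literature.Analysis.FluidPDE.nthMarginal_of_le hs]
        exact Literature.Analysis.FluidPDE.marginal_nonneg _ _ (fun z => bgsrInitialDensity_nonneg hβ hρ₀0 _) Z
      rw [abs_of_nonneg hnn, nthMarginal_bgsrInitialDensity_eq hs]
      have h32 := nthMarginal_canonicalDensity_le_two_pow (d := d) (β := β) (ε := ε) hβ hε.le hs hn Z
      have hmc : 0 < maxwellianConst d β := maxwellianConst_pos hβ
      calc ρ₀ (Z 0).1 * nthMarginal (N + 1) (s + 1)
            (Literature.Analysis.FluidPDE.canonicalDensity (Literature.Analysis.FluidPDE.Torus.geometry d) ε (N + 1)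
              fun p : UnitAddTorus d × EuclideanSpace ℝ d => maxwellianBeta β p.2) Z
          ≤ R * (2 ^ (s + 1) * tensorPow (s + 1) (fun p : UnitAddTorus d × EuclideanSpace ℝ d => maxwellianBeta β p.2) Z) :=
            mul_le_mul (hR _) h32
              (Literature.Analysis.FluidPDE.nthMarginal_nonneg _ _ (fun z => ?_) _) hR0
        _ = R * (2 * maxwellianConst d β) ^ (s + 1) * exp (-β * configEnergy Z) := by
            rw [tensorPow_maxwellianBeta, mul_pow]; ring
        _ ≤ R * (max 1 (2 * maxwellianConst d β)) ^ (s + 1) * exp (-β * configEnergy Z) := by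
            gcongr; exact le_max_right _ _
      exact canonicalDensity_maxwellianBeta_nonneg hβ z
    · simp only [Literature.Analysis.FluidPDE.nthMarginal, dif_neg hs, Pi.zero_apply, abs_zero]
      positivity

/-- The honest initial marginals are in the Lanford class (measurable `0 ≤ ρ⁰ ≤ R`, `β > 0`,
`N (2ε)^d ≤ 1/2`). [folklore] -/
theorem isNice_bgsrInitialMarginals (hβ : 0 < β) (hρ₀m : Measurable ρ₀) {R : ℝ} (hρ₀0 : ∀ x, 0 ≤ ρ₀ x)
    (hR : ∀ x, ρ₀ x ≤ R) (hN : (N : ℝ) * (2 * ε) ^ Fintype.card d ≤ 2⁻¹) (s : ℕ) :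
    IsNice (bgsrInitialMarginals hε hε' N β ρ₀ s) :=
  ⟨measurable_bgsrInitialMarginals hρ₀m s, R * (max 1 (2 * maxwellianConst d β)) ^ s, β, hβ,
    abs_bgsrInitialMarginals_le hβ hρ₀0 hR hN s⟩

/-- The honest initial marginals obey the level bound `R (max 1 (2(β/2π)^{d/2}))^s e^{-βH}` of the
pruning estimates at all levels. [folklore] -/
theorem isLevelBdd_bgsrInitialMarginals (hβ : 0 < β) {R : ℝ} (hρ₀0 : ∀ x, 0 ≤ ρ₀ x)
    (hR : ∀ x, ρ₀ x ≤ R) (hN : (N : ℝ) * (2 * ε) ^ Fintype.card d ≤ 2⁻¹) (L : ℕ) :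
    IsLevelBdd (bgsrInitialMarginals hε hε' N β ρ₀) L R (max 1 (2 * maxwellianConst d β)) β :=
  fun a _ Z => abs_bgsrInitialMarginals_le hβ hρ₀0 hR hN a Z

/-! ## §4. The relational bound of the data on coupled pairs -/

/-- **BGSR Prop. 5.7, second bullet, with Prop. 3.3: the data of the two expansions are close on
coupled pairs.** For `N + 1` hard spheres of diameter `ε` on `T^d` (`0 < ε < 1/2`,
`N (2ε)^d ≤ 1/2`), BGSR's datum with `0 ≤ ρ⁰ ≤ R` continuous, `β > 0`, `α ≥ 0`, levels
`L ≤ N + 1` and any energy cut-off `E`: on the coupled pairs of `bgsrCouplingUpTo` transported by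
`t' ∈ [δ, σ]` (same velocities, same position of the tagged particle, BBGKY configuration a good
point hence in `D_ε`), the energy-truncated honest initial marginals `1_{H ≤ E²/2} f_N^{0(s)}` and
the energy-truncated factorised datum `1_{H ≤ E²/2} ρ⁰(x₀) M_β^{⊗s}` of the Boltzmann hierarchy
differ by at most `2R(N+1)(2ε)^d (max 1 (4(β/2π)^{d/2}))^s e^{-βH}` ("`g^{0(J_K)}(Z_{J_K}(0)) =
g^{0(J_K)}(Z^0_{J_K}(0))` … `g^{0(J_K)}` is independent of these positions"; Prop. 3.3 with
`(s+1)2^{s+1} ≤ 2·4^s`). [cite: BodineauGallagherSaintRaymondInvent2016, §5.3.3 Prop. 5.7 proof, p. 21] -/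
theorem isRelLevelBddT_bgsrInitialMarginals (hβ : 0 < β) {α : ℝ} {R : ℝ} (hρ₀0 : ∀ x, 0 ≤ ρ₀ x)
    (hR : ∀ x, ρ₀ x ≤ R) (hN : (N : ℝ) * (2 * ε) ^ Fintype.card d ≤ 2⁻¹) {L : ℕ} (hL : L ≤ N + 1)
    (E t ε₀ : ℝ) {δ : ℝ} (hδ : 0 ≤ δ) :
    (bgsrCouplingUpTo (d := d) hε hε' (N + 1) α ε₀ hδ t).IsRelLevelBddT
      (energyTruncate E (bgsrInitialMarginals hε hε' N β ρ₀))
      (energyTruncate E fun a Z => bgsrHierarchyFamily β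
        (linearBoltzmannSeries (Literature.Analysis.FluidPDE.Torus.geometry d) β α fun x _ => ρ₀ x) a 0 Z)
      L (2 * R * (N + 1) * (2 * ε) ^ Fintype.card d) (max 1 (4 * maxwellianConst d β)) β 0 := by
  have hR0 : 0 ≤ R := (hρ₀0 0).trans (hR 0)
  have hmc : 0 < maxwellianConst d β := maxwellianConst_pos hβ
  intro a ha σ p hp t' ht'
  rw [mem_bgsrCouplingUpTo_rel] at hp
  obtain ⟨-, ha0, -, -, hready⟩ := hp
  obtain ⟨a, rfl⟩ : ∃ a', a = a' + 1 := Nat.exists_eq_succ_of_ne_zero ha0.ne'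
  rw [hsHierarchyModel_flow, boltzmannModel_flow]
  set Z' := Literature.Analysis.FluidPDE.Alexander.regFlow (Literature.Analysis.FluidPDE.Torus.geometry d) ε (-t') p.1
    with hZ'
  set Y' := freeFlight (Literature.Analysis.FluidPDE.Torus.geometry d) (-t') p.2 with hY'
  have ht'' : t' ∈ Icc δ σ := ⟨ht'.1, by simpa using ht'.2⟩
  obtain ⟨hvel, -, hx0, -, hZgood⟩ := hready t' ht''
  have hHeq : configEnergy Z' = configEnergy Y' := configEnergy_eq_of_vel_eq hvel
  have hHY : configEnergy Y' = configEnergy p.2 :=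
    Literature.Analysis.FluidPDE.configEnergy_freeFlight _ _ _
  have hRHS0 : 0 ≤ 2 * R * (N + 1) * (2 * ε) ^ Fintype.card d * (max 1 (4 * maxwellianConst d β)) ^ (a + 1) *
      exp (-β * configEnergy p.2) := by
    have := hε.le; positivity
  rw [energyTruncate_apply, energyTruncate_apply, hHeq]
  split_ifs with hcut
  · -- the factorised datum at `Y'`, read at `Z'`
    have hx : (Z' 0).1 = (Y' 0).1 := hx0 0 rfl
    have hT : ∀ W : Config (a + 1) d (UnitAddTorus d), maxwellianTensor β (a + 1) W =
        maxwellianConst d β ^ (a + 1) * exp (-β * configEnergy W) := fun W =>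
      tensorPow_maxwellianBeta β W
    have hG0 : bgsrHierarchyFamily β
          (linearBoltzmannSeries (Literature.Analysis.FluidPDE.Torus.geometry d) β α fun x _ => ρ₀ x) (a + 1) 0 Y' =
        ρ₀ (Z' 0).1 * tensorPow (a + 1) (fun q : UnitAddTorus d × EuclideanSpace ℝ d => maxwellianBeta β q.2) Z' := by
      rw [bgsrHierarchyFamily_succ, linearBoltzmannSeries_zero, ← hx]
      change ρ₀ (Z' 0).1 * maxwellianTensor β (a + 1) Y' = ρ₀ (Z' 0).1 * maxwellianTensor β (a + 1) Z'
      rw [hT, hT, hHeq]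
    rw [hG0, bgsrInitialMarginals_succ]
    have hZ'D : Z' ∈ hardSphereDomain (Literature.Analysis.FluidPDE.Torus.geometry d) (a + 1) ε :=
      Literature.Analysis.FluidPDE.Alexander.good_subset_hardSphereDomain hZgood
    have hs : a + 1 ≤ N + 1 := ha.trans hL
    have h33 := abs_nthMarginal_bgsrInitialDensity_sub_le (d := d) (ε := ε) (β := β) (N := N) (ρ₀ := ρ₀)
      hβ hε.le hρ₀0 hR hs hN hZ'D
    refine h33.trans ?_
    have hTZ : tensorPow (a + 1) (fun q : UnitAddTorus d × EuclideanSpace ℝ d => maxwellianBeta β q.2) Z' =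
        maxwellianConst d β ^ (a + 1) * exp (-β * configEnergy p.2) := by
      rw [← hHY, ← hHeq]; exact tensorPow_maxwellianBeta β Z'
    rw [hTZ]
    have hcomb : ((a : ℝ) + 2) * 2 ^ (a + 2) * maxwellianConst d β ^ (a + 1) ≤
        2 * (max 1 (4 * maxwellianConst d β)) ^ (a + 1) := by
      have h1 := succ_succ_mul_two_pow_le a
      have h2 : (4 : ℝ) ^ (a + 1) * maxwellianConst d β ^ (a + 1) ≤ (max 1 (4 * maxwellianConst d β)) ^ (a + 1) := by
        rw [← mul_pow]
        exact pow_le_pow_left₀ (by positivity) (le_max_right _ _) _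
      calc ((a : ℝ) + 2) * 2 ^ (a + 2) * maxwellianConst d β ^ (a + 1)
          ≤ 2 * 4 ^ (a + 1) * maxwellianConst d β ^ (a + 1) := by gcongr
        _ = 2 * (4 ^ (a + 1) * maxwellianConst d β ^ (a + 1)) := by ring
        _ ≤ 2 * (max 1 (4 * maxwellianConst d β)) ^ (a + 1) := by gcongr
    have hpos : 0 ≤ R * ((N + 1 : ℕ) : ℝ) * (2 * ε) ^ Fintype.card d * exp (-β * configEnergy p.2) := by
      have := hε.le; positivity
    calc R * ((((a + 1 : ℕ) : ℝ) + 1) * 2 ^ (a + 1 + 1) * ((N + 1 : ℕ) : ℝ) * (2 * ε) ^ Fintype.card d) *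
          (maxwellianConst d β ^ (a + 1) * exp (-β * configEnergy p.2))
        = (R * ((N + 1 : ℕ) : ℝ) * (2 * ε) ^ Fintype.card d * exp (-β * configEnergy p.2)) *
            (((a : ℝ) + 2) * 2 ^ (a + 2) * maxwellianConst d β ^ (a + 1)) := by push_cast; ring
      _ ≤ (R * ((N + 1 : ℕ) : ℝ) * (2 * ε) ^ Fintype.card d * exp (-β * configEnergy p.2)) *
            (2 * (max 1 (4 * maxwellianConst d β)) ^ (a + 1)) := mul_le_mul_of_nonneg_left hcomb hpos
      _ = _ := by push_cast; ring
  · rw [sub_zero, abs_zero]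
    exact hRHS0

end Data

end Kinetic

end

end Literature.MathematicalPhysics.KineticTheory
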